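import Mathlib
import HarnessLib
import Literature.Probability.MarkovChains.PeskunOrdering
import Summits.Ventures.LatticeQCDFlow.Exactness.SharedNoiseAcceptance

/-!
# LatticeQCDFlow / Exactness — the one-pseudofermion stochastic acceptance costs integrated
# autocorrelation for EVERY observable (Peskun's theorem applied to the Carnot bound)

HONEST FRAMING: exact (Metropolis-corrected) sampling algorithms for lattice gauge theory;
figures of merit are autocorrelation/cost numbers at stated couplings and volumes; no
continuum-physics claim.

Venture `LatticeQCDFlow` (cell pub-lqcd), topic `Exactness`; FANOUT row 38 (r2-scope, gen 16), the
Lean face of HOME/R2-SCOPE.md §3 E2 D1 / §4 "Reading of the table" (v1.0.36): NEW WORK of the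
cell (a two-line corollary), not a published result.  `SharedNoiseAcceptance.lean` proves that the
shared-single-noise chain `hbKernel T p` on the gauge space `X` (draw ONE pseudofermion from the
current state's heat-bath, accept with the conditional Metropolis–Hastings rate — the `N_η = 1`
stochastic acceptance of Knechtli–Wolff 2003 §4.1 / the Gibbs sampler `A_G` of Albergo et al. 2021
§III.B) is exact for the marginal `margX p` and that its off-diagonal rates are at most those of
the exact-determinant Metropolis–Hastings kernel `mhKernel T (margX p)` for the SAME proposal `T`
(`hbRate_le_mhRate`, Knechtli–Wolff's "Carnot" inequality (4.9)).  That inequality is exactly the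
hypothesis "`P₂ ≤ P₁` off the diagonal" of PESKUN'S THEOREM
(`Literature.Probability.MarkovChains.asympVar_le_of_offDiag_le`, [Peskun 1973, Thm 2.1.1]), both
kernels being reversible for `margX p`; hence, whenever the stochastic chain is irreducible, the
exact-determinant chain has the smaller asymptotic variance `v(f, π, P) = lim N·var(Î)`
(Kemeny–Snell's `f(2BZ − B − BA)fᵀ`, tree `asympVar`; `= 2 τ_int,f · var_π f`) for EVERY
observable `f` — the chain-mode (τ_int) content of "the fermion estimator can only cost" at a fixed
proposal, complementing the reweight-mode ESS statement `essFrac_le_essFrac_margU` (T2-K).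

Results (all proved, finite):
* `hbRate_nonneg`, `hbKernel_isRowStochastic` — the shared-noise chain is a stochastic matrix for a
  non-negative proposal matrix with row sums `≤ 1`;
* `asympVar_mhKernel_le_asympVar_hbKernel` — for every `f`,
  `asympVar f (margX p) (mhKernel T (margX p)) ≤ asympVar f (margX p) (hbKernel T p)`
  (joint weight normalised, `hbKernel T p` irreducible).
Nothing here is specific to fermions; nothing is claimed about the size of the gap.
-/

namespace Summit.Ventures.LatticeQCDFlow.Exactness

open Finset Matrix Literature.Probability.MarkovChains

variable {X Φ : Type*} [Fintype X] [Fintype Φ] [DecidableEq X]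

omit [Fintype X] [DecidableEq X] in
/-- The shared-noise off-diagonal rate is non-negative for a non-negative proposal matrix.
[folklore] -/
theorem hbRate_nonneg [Nonempty Φ] {p : X → Φ → ℝ} (hp : ∀ x φ, 0 < p x φ) {T : X → X → ℝ}
    (hT : ∀ x y, 0 ≤ T x y) (x y : X) : 0 ≤ hbRate T p x y :=
  sum_nonneg fun φ _ =>
    mul_nonneg (hbCond_pos hp x φ).le (mhRate_nonneg hT (fun z => hp z φ) x y)

/-- The shared-noise chain is ROW-STOCHASTIC (non-negative entries, unit row sums) when the
proposal matrix is non-negative with row sums `≤ 1`: off the diagonal `0 ≤ hbRate ≤ mhRate ≤ T`,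
so the rejected mass on the diagonal is non-negative. [folklore] -/
theorem hbKernel_isRowStochastic [Nonempty Φ] {p : X → Φ → ℝ} (hp : ∀ x φ, 0 < p x φ)
    {T : X → X → ℝ} (hT : ∀ x y, 0 ≤ T x y) (hTrow : ∀ x, ∑ y, T x y ≤ 1) :
    IsRowStochastic (hbKernel T p) := by
  refine ⟨fun x y => ?_, hbKernel_sum_eq_one T p⟩
  by_cases h : y = x
  · subst h
    rw [hbKernel_self, sub_nonneg]
    calc ∑ z ∈ univ.erase y, hbRate T p y z ≤ ∑ z ∈ univ.erase y, T y z :=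
          sum_le_sum fun z _ =>
            (hbRate_le_mhRate hp T y z).trans (mhRate_le T (margX p) y z)
      _ ≤ ∑ z, T y z := sum_le_sum_of_subset_of_nonneg (erase_subset _ _) fun z _ _ => hT y z
      _ ≤ 1 := hTrow y
  · rw [hbKernel_of_ne T p h]
    exact hbRate_nonneg hp hT x y

/-- **The Carnot bound costs integrated autocorrelation, observable by observable.**  For a
normalised positive joint weight `p` on `X × Φ` (gauge field × pseudofermion), a non-negative
proposal matrix `T` with row sums `≤ 1`, and an irreducible shared-noise chain `hbKernel T p`:
for EVERY observable `f : X → ℝ` the exact-determinant Metropolis–Hastings chain for the marginal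
`margX p` with the same proposal has the smaller asymptotic variance,
`v(f, margX p, mhKernel T (margX p)) ≤ v(f, margX p, hbKernel T p)` — Peskun's theorem
[Peskun 1973, Thm 2.1.1] (tree `asympVar_le_of_offDiag_le`) applied to `hbRate_le_mhRate`, both
kernels being reversible for `margX p` (`mhKernel_detailedBalance`, `hb_detailedBalance`).
Venture corollary (NEW WORK; cell reading R2-SCOPE.md §3 E2 D1). [folklore] -/
theorem asympVar_mhKernel_le_asympVar_hbKernel [Nonempty Φ] {p : X → Φ → ℝ}
    (hp : ∀ x φ, 0 < p x φ) (hp1 : ∑ x, margX p x = 1) {T : X → X → ℝ} (hT : ∀ x y, 0 ≤ T x y)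
    (hTrow : ∀ x, ∑ y, T x y ≤ 1)
    (hirr : Literature.Probability.MarkovChains.IsIrreducible (hbKernel T p : Matrix X X ℝ))
    (f : X → ℝ) :
    asympVar f (margX p) (mhKernel T (margX p)) ≤ asympVar f (margX p) (hbKernel T p) :=
  asympVar_le_of_offDiag_le (margX_pos hp) hp1
    (mhKernel_isRowStochastic hT hTrow (margX_pos hp)) (hbKernel_isRowStochastic hp hT hTrow)
    (mhKernel_detailedBalance (margX_pos hp) T) (hb_detailedBalance hp T) hirr
    (fun x y hxy => by
      rw [show (hbKernel T p : Matrix X X ℝ) x y = hbRate T p x y from hbKernel_of_ne T p hxy.symm,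
        show (mhKernel T (margX p) : Matrix X X ℝ) x y = mhRate T (margX p) x y from
          mhKernel_of_ne hxy.symm]
      exact hbRate_le_mhRate hp T x y)
    f

end Summit.Ventures.LatticeQCDFlow.Exactness
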